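import Mathlib

/-!
# Crux `UniformPhotonSphereChannelsR` (K1R, stmt-FinalStateConjecture-14074), line
# `crum-peeling-recessive-tower` — stub `stub_seriesChain`, helper 1: real power-series calculus

Support file (pure real analysis, no definitions) for `stub_seriesChain` — the analytic germs
`W_k = −(λ_k/r)·ω_k(M/r)`, `ω_k(w) = Σ Ω_{k,n} wⁿ`, solve the recessive Riccati/Crum chain of the
Regge–Wheeler potentials.  For a real coefficient sequence `a` with geometric control
`|a n| ≤ Rⁿ` (`R ≥ 1`) and `|w| < 1/(2R)` (so every term is `≤ 2⁻ⁿ` up to a polynomial):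

* `summable_norm_mul_pow`, `summable_norm_succ_mul_mul_pow` : absolute convergence of
  `Σ aₙ wⁿ` and `Σ (n+1) aₙ wⁿ`;
* `hasDerivAt_tsum_mul_pow_succ` : `d/dw Σ aₙ wⁿ⁺¹ = Σ (n+1) aₙ wⁿ` (term-wise differentiation,
  Mathlib's `hasDerivAt_tsum_of_isPreconnected` on the interval `|w| < 1/(2R)`);
* `tendsto_tsum_mul_pow_nhds_zero` : `Σ aₙ wⁿ → a₀` as `w → 0` (uniform convergence);
* `seriesChain_riccatiForm` (registered sub-goal) : the Cauchy-product/shift bookkeeping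
  `Σₙ [c² Σ_{i≤n} aᵢ aₙ₋ᵢ + c((n+1)aₙ − 2n aₙ₋₁)] wⁿ = c² (Σ aₙwⁿ)² + c (1 − 2w) Σ (n+1)aₙwⁿ`,
  and its two consequences `riccatiForm_eq_poly` (a coefficient sequence supported on `n ≤ 2`
  sums to a quadratic polynomial — the rung-0 recursion of the line) and
  `riccatiForm_eq_of_coeff_eq` (equal coefficients, equal sums — the rung maps of the line).

Elementary; no new mathematics (Cauchy product of absolutely convergent real series and
differentiation of a power series inside its disc of convergence).
-/

-- `Summit.<S>.<S>` repeats a namespace component by design (D-0017); off here as in the lakefile.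
set_option linter.dupNamespace false

noncomputable section

namespace Summit.FinalStateConjecture.FinalStateConjecture.Theorems.CrumPeelingRecessiveTower

open Filter Set Topology

variable {a : ℕ → ℝ} {R : ℝ}

/-- If `R ≥ 1` and `|w| < 1/(2R)` then `0 ≤ R|w| < 1/2`. [folklore] -/
theorem mul_abs_lt_half (hR : 1 ≤ R) {w : ℝ} (hw : |w| < 1 / (2 * R)) : R * |w| < 1 / 2 := by
  have h2R : (0 : ℝ) < 2 * R := by linarith
  have h := (lt_div_iff₀ h2R).1 hw
  linarith

/-- Geometric control of the terms: `|aₙ wⁿ| ≤ (R|w|)ⁿ` when `|aₙ| ≤ Rⁿ`. [folklore] -/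
theorem norm_mul_pow_le (ha : ∀ n, |a n| ≤ R ^ n) (w : ℝ) (n : ℕ) :
    ‖a n * w ^ n‖ ≤ (R * |w|) ^ n := by
  rw [Real.norm_eq_abs, abs_mul, abs_pow, mul_pow]
  exact mul_le_mul_of_nonneg_right (ha n) (pow_nonneg (abs_nonneg w) n)

/-- `Σ (n+1) qⁿ` converges for `0 ≤ q < 1`. [folklore] -/
theorem summable_succ_mul_geometric {q : ℝ} (hq0 : 0 ≤ q) (hq1 : q < 1) :
    Summable (fun n : ℕ => ((n : ℝ) + 1) * q ^ n) := by
  have hq : ‖q‖ < 1 := by rwa [Real.norm_eq_abs, abs_of_nonneg hq0]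
  have h1 := summable_pow_mul_geometric_of_norm_lt_one 1 hq
  have h2 := summable_geometric_of_lt_one hq0 hq1
  refine (h1.add h2).congr fun n => ?_
  ring

/-- Absolute convergence of `Σ aₙ wⁿ` for `|aₙ| ≤ Rⁿ`, `R ≥ 1`, `|w| < 1/(2R)`. [folklore] -/
theorem summable_norm_mul_pow (hR : 1 ≤ R) (ha : ∀ n, |a n| ≤ R ^ n) {w : ℝ}
    (hw : |w| < 1 / (2 * R)) : Summable (fun n => ‖a n * w ^ n‖) := by
  have hq0 : 0 ≤ R * |w| := mul_nonneg (by linarith) (abs_nonneg w)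
  have hq1 : R * |w| < 1 := by linarith [mul_abs_lt_half hR hw]
  exact Summable.of_nonneg_of_le (fun n => norm_nonneg _) (norm_mul_pow_le ha w)
    (summable_geometric_of_lt_one hq0 hq1)

/-- Absolute convergence of the derived series `Σ (n+1) aₙ wⁿ` for `|aₙ| ≤ Rⁿ`, `R ≥ 1`,
`|w| < 1/(2R)`. [folklore] -/
theorem summable_norm_succ_mul_mul_pow (hR : 1 ≤ R) (ha : ∀ n, |a n| ≤ R ^ n) {w : ℝ}
    (hw : |w| < 1 / (2 * R)) : Summable (fun n : ℕ => ‖((n : ℝ) + 1) * a n * w ^ n‖) := by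
  have hq0 : 0 ≤ R * |w| := mul_nonneg (by linarith) (abs_nonneg w)
  have hq1 : R * |w| < 1 := by linarith [mul_abs_lt_half hR hw]
  refine Summable.of_nonneg_of_le (fun n => norm_nonneg _) (fun n => ?_)
    (summable_succ_mul_geometric hq0 hq1)
  have hn : (0 : ℝ) ≤ (n : ℝ) + 1 := by positivity
  calc ‖((n : ℝ) + 1) * a n * w ^ n‖ = ((n : ℝ) + 1) * ‖a n * w ^ n‖ := by
        rw [mul_assoc, norm_mul, Real.norm_eq_abs ((n : ℝ) + 1), abs_of_nonneg hn]
    _ ≤ ((n : ℝ) + 1) * (R * |w|) ^ n :=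
        mul_le_mul_of_nonneg_left (norm_mul_pow_le ha w n) hn

/-- **Term-wise differentiation.**  For `|aₙ| ≤ Rⁿ` (`R ≥ 1`) and `|w| < 1/(2R)`,
`d/dw Σ aₙ wⁿ⁺¹ = Σ (n+1) aₙ wⁿ`. [folklore] -/
theorem hasDerivAt_tsum_mul_pow_succ (hR : 1 ≤ R) (ha : ∀ n, |a n| ≤ R ^ n) {w : ℝ}
    (hw : |w| < 1 / (2 * R)) :
    HasDerivAt (fun w => ∑' n, a n * w ^ (n + 1)) (∑' n : ℕ, ((n : ℝ) + 1) * a n * w ^ n) w := by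
  have h2R : (0 : ℝ) < 2 * R := by linarith
  set ρ : ℝ := 1 / (2 * R) with hρ
  have hρ0 : 0 < ρ := by positivity
  have hmem : ∀ y : ℝ, y ∈ Ioo (-ρ) ρ ↔ |y| < ρ := fun y => by rw [mem_Ioo, abs_lt]
  have hg : ∀ (n : ℕ) (y : ℝ), y ∈ Ioo (-ρ) ρ →
      HasDerivAt (fun w => a n * w ^ (n + 1)) (((n : ℝ) + 1) * a n * y ^ n) y := by
    intro n y _
    have h := (hasDerivAt_pow (n + 1) y).const_mul (a n)
    refine h.congr_deriv ?_
    rw [Nat.add_sub_cancel]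
    push_cast
    ring
  have hg' : ∀ (n : ℕ) (y : ℝ), y ∈ Ioo (-ρ) ρ →
      ‖((n : ℝ) + 1) * a n * y ^ n‖ ≤ ((n : ℝ) + 1) * (1 / 2) ^ n := by
    intro n y hy
    rw [hmem] at hy
    have hn : (0 : ℝ) ≤ (n : ℝ) + 1 := by positivity
    have hRy : R * |y| ≤ 1 / 2 := by
      have := (lt_div_iff₀ h2R).1 hy
      nlinarith
    have hq0 : 0 ≤ R * |y| := mul_nonneg (by linarith) (abs_nonneg y)
    calc ‖((n : ℝ) + 1) * a n * y ^ n‖ = ((n : ℝ) + 1) * ‖a n * y ^ n‖ := by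
          rw [mul_assoc, norm_mul, Real.norm_eq_abs ((n : ℝ) + 1), abs_of_nonneg hn]
      _ ≤ ((n : ℝ) + 1) * (R * |y|) ^ n := mul_le_mul_of_nonneg_left (norm_mul_pow_le ha y n) hn
      _ ≤ ((n : ℝ) + 1) * (1 / 2) ^ n :=
          mul_le_mul_of_nonneg_left (pow_le_pow_left₀ hq0 hRy n) hn
  have hu : Summable (fun n : ℕ => ((n : ℝ) + 1) * (1 / 2 : ℝ) ^ n) :=
    summable_succ_mul_geometric (by norm_num) (by norm_num)
  have h0 : (0 : ℝ) ∈ Ioo (-ρ) ρ := by rw [hmem, abs_zero]; exact hρ0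
  have hg0 : Summable (fun n => a n * (0 : ℝ) ^ (n + 1)) := by
    simp only [ne_eq, Nat.add_eq_zero_iff, one_ne_zero, and_false, not_false_eq_true, zero_pow,
      mul_zero]
    exact summable_zero
  have hy : w ∈ Ioo (-ρ) ρ := by rw [hmem]; exact hw
  exact hasDerivAt_tsum_of_isPreconnected hu isOpen_Ioo isPreconnected_Ioo hg hg' h0 hg0 hy

/-- **Continuity at the origin.**  For `|aₙ| ≤ Rⁿ` (`R ≥ 1`), `Σ aₙ wⁿ → a₀` as `w → 0`.
[folklore] -/
theorem tendsto_tsum_mul_pow_nhds_zero (hR : 1 ≤ R) (ha : ∀ n, |a n| ≤ R ^ n) :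
    Tendsto (fun w => ∑' n, a n * w ^ n) (𝓝 0) (𝓝 (a 0)) := by
  have h2R : (0 : ℝ) < 2 * R := by linarith
  set ρ : ℝ := 1 / (2 * R) with hρ
  have hρ0 : 0 < ρ := by positivity
  have hmem : ∀ y : ℝ, y ∈ Ioo (-ρ) ρ ↔ |y| < ρ := fun y => by rw [mem_Ioo, abs_lt]
  have hcont : ContinuousOn (fun w => ∑' n, a n * w ^ n) (Ioo (-ρ) ρ) := by
    refine continuousOn_tsum (u := fun n : ℕ => (1 / 2 : ℝ) ^ n)
      (fun n => (continuousOn_const.mul (continuousOn_pow n))) ?_ ?_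
    · exact summable_geometric_of_lt_one (by norm_num) (by norm_num)
    · intro n y hy
      rw [hmem] at hy
      have hRy : R * |y| ≤ 1 / 2 := by
        have := (lt_div_iff₀ h2R).1 hy
        nlinarith
      have hq0 : 0 ≤ R * |y| := mul_nonneg (by linarith) (abs_nonneg y)
      exact (norm_mul_pow_le ha y n).trans (pow_le_pow_left₀ hq0 hRy n)
  have h0 : (0 : ℝ) ∈ Ioo (-ρ) ρ := by rw [hmem, abs_zero]; exact hρ0
  have hca : ContinuousAt (fun w => ∑' n, a n * w ^ n) 0 :=
    hcont.continuousAt (isOpen_Ioo.mem_nhds h0)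
  have h0val : ∑' n, a n * (0 : ℝ) ^ n = a 0 := by
    rw [tsum_eq_single 0 (fun n hn => by simp [hn])]
    simp
  have := hca.tendsto
  rwa [h0val] at this

/-- The shifted power series: `Σ aₙ wⁿ⁺¹ = w · Σ aₙ wⁿ` (unconditionally, `tsum_mul_right`).
[folklore] -/
theorem tsum_mul_pow_succ (a : ℕ → ℝ) (w : ℝ) :
    ∑' n, a n * w ^ (n + 1) = w * ∑' n, a n * w ^ n := by
  rw [mul_comm w, ← tsum_mul_right]
  refine tsum_congr fun n => ?_
  ring

/-- **Cauchy-product/shift bookkeeping (the Riccati form of a germ).**  For `|aₙ| ≤ Rⁿ`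
(`R ≥ 1`), `|w| < 1/(2R)` and a constant `c`, with `S = Σ aₙ wⁿ`, `D = Σ (n+1) aₙ wⁿ`:
`Σₙ [c² Σ_{i≤n} aᵢ aₙ₋ᵢ + c((n+1) aₙ − 2n aₙ₋₁)] wⁿ = c² S² + c (1 − 2w) D`. [folklore] -/
theorem seriesChain_riccatiForm :
    ∀ (a : ℕ → ℝ) (R : ℝ), 1 ≤ R → (∀ n, |a n| ≤ R ^ n) → ∀ (w : ℝ), |w| < 1 / (2 * R) →
      ∀ (c : ℝ), HasSum (fun n => (c ^ 2 * ∑ i ∈ Finset.range (n + 1), a i * a (n - i)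
        + c * (((n : ℝ) + 1) * a n - 2 * (n : ℝ) * a (n - 1))) * w ^ n)
        (c ^ 2 * (∑' n, a n * w ^ n) ^ 2
          + c * (1 - 2 * w) * ∑' n : ℕ, ((n : ℝ) + 1) * a n * w ^ n) := by
  intro a R hR ha w hw c
  set S : ℝ := ∑' n, a n * w ^ n with hS
  set D : ℝ := ∑' n : ℕ, ((n : ℝ) + 1) * a n * w ^ n with hD
  have hSn := summable_norm_mul_pow hR ha hw
  have hDn := summable_norm_succ_mul_mul_pow hR ha hw
  -- Cauchy product
  have hC : HasSum (fun n => (∑ i ∈ Finset.range (n + 1), a i * a (n - i)) * w ^ n) (S * S) := by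
    refine (hasSum_sum_range_mul_of_summable_norm hSn hSn).congr_fun fun n => ?_
    rw [Finset.sum_mul]
    refine Finset.sum_congr rfl fun i hi => ?_
    have hi' : i ≤ n := Nat.lt_succ_iff.mp (Finset.mem_range.mp hi)
    calc a i * a (n - i) * w ^ n = a i * a (n - i) * (w ^ i * w ^ (n - i)) := by
          rw [← pow_add, Nat.add_sub_cancel' hi']
      _ = a i * w ^ i * (a (n - i) * w ^ (n - i)) := by ring
  -- the derived series
  have hDs : HasSum (fun n : ℕ => ((n : ℝ) + 1) * a n * w ^ n) D := hDn.of_norm.hasSum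
  -- its shift `Σ 2n aₙ₋₁ wⁿ = 2w D`
  have hsh : HasSum (fun n : ℕ => 2 * (n : ℝ) * a (n - 1) * w ^ n) (2 * w * D) := by
    refine (hasSum_nat_add_iff' (f := fun n : ℕ => 2 * (n : ℝ) * a (n - 1) * w ^ n) 1).mp ?_
    simp only [Finset.sum_range_one, Nat.cast_zero, mul_zero, zero_mul, sub_zero,
      Nat.add_sub_cancel]
    refine (hDs.mul_left (2 * w)).congr_fun fun n => ?_
    push_cast
    ring
  have hsum := ((hC.mul_left (c ^ 2)).add (hDs.mul_left c)).sub (hsh.mul_left c)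
  rw [show c ^ 2 * S ^ 2 + c * (1 - 2 * w) * D = c ^ 2 * (S * S) + c * D - c * (2 * w * D) by ring]
  exact hsum.congr_fun fun n => by ring

/-- **Rung-0 form.**  If the coefficients of the Riccati form vanish beyond degree two, with
values `E₀, E₁, E₂` in degrees `0, 1, 2`, then `c² S² + c(1 − 2w) D = E₀ + E₁ w + E₂ w²` on
`|w| < 1/(2R)`. [folklore] -/
theorem riccatiForm_eq_poly (hR : 1 ≤ R) (ha : ∀ n, |a n| ≤ R ^ n) {w : ℝ}
    (hw : |w| < 1 / (2 * R)) {c E₀ E₁ E₂ : ℝ}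
    (hrec : ∀ n, c ^ 2 * ∑ i ∈ Finset.range (n + 1), a i * a (n - i)
          + c * (((n : ℝ) + 1) * a n - 2 * (n : ℝ) * a (n - 1))
          = (if n = 0 then E₀ else if n = 1 then E₁ else if n = 2 then E₂ else 0)) :
    c ^ 2 * (∑' n, a n * w ^ n) ^ 2 + c * (1 - 2 * w) * ∑' n : ℕ, ((n : ℝ) + 1) * a n * w ^ n
      = E₀ + E₁ * w + E₂ * w ^ 2 := by
  have h1 := seriesChain_riccatiForm a R hR ha w hw c
  have h2 : HasSum (fun n => (c ^ 2 * ∑ i ∈ Finset.range (n + 1), a i * a (n - i)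
        + c * (((n : ℝ) + 1) * a n - 2 * (n : ℝ) * a (n - 1))) * w ^ n)
      (∑ n ∈ Finset.range 3, (c ^ 2 * ∑ i ∈ Finset.range (n + 1), a i * a (n - i)
        + c * (((n : ℝ) + 1) * a n - 2 * (n : ℝ) * a (n - 1))) * w ^ n) := by
    refine hasSum_sum_of_ne_finset_zero fun n hn => ?_
    have h3 : 3 ≤ n := by simpa using hn
    rw [hrec n, if_neg (by omega), if_neg (by omega), if_neg (by omega), zero_mul]
  rw [h1.unique h2, Finset.sum_range_succ, Finset.sum_range_succ, Finset.sum_range_one, hrec 0,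
    hrec 1, hrec 2]
  simp only [if_true, one_ne_zero, if_false, OfNat.ofNat_ne_zero, OfNat.ofNat_ne_one]
  ring

/-- **Rung-map form.**  If the Riccati-form coefficients of `(b, d)` equal those of `(a, −c)`
degree by degree, then `d² S_b² + d(1 − 2w) D_b = c² S_a² − c(1 − 2w) D_a` on `|w| < 1/(2R)`.
[folklore] -/
theorem riccatiForm_eq_of_coeff_eq (hR : 1 ≤ R) {b : ℕ → ℝ} (ha : ∀ n, |a n| ≤ R ^ n)
    (hb : ∀ n, |b n| ≤ R ^ n) {w : ℝ} (hw : |w| < 1 / (2 * R)) {c d : ℝ}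
    (hrec : ∀ n, d ^ 2 * ∑ i ∈ Finset.range (n + 1), b i * b (n - i)
          + d * (((n : ℝ) + 1) * b n - 2 * (n : ℝ) * b (n - 1))
        = c ^ 2 * ∑ i ∈ Finset.range (n + 1), a i * a (n - i)
          - c * (((n : ℝ) + 1) * a n - 2 * (n : ℝ) * a (n - 1))) :
    d ^ 2 * (∑' n, b n * w ^ n) ^ 2 + d * (1 - 2 * w) * ∑' n : ℕ, ((n : ℝ) + 1) * b n * w ^ n
      = c ^ 2 * (∑' n, a n * w ^ n) ^ 2
        - c * (1 - 2 * w) * ∑' n : ℕ, ((n : ℝ) + 1) * a n * w ^ n := by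
  have h1 := seriesChain_riccatiForm b R hR hb w hw d
  have h2 := seriesChain_riccatiForm a R hR ha w hw (-c)
  have h3 : HasSum (fun n => (d ^ 2 * ∑ i ∈ Finset.range (n + 1), b i * b (n - i)
        + d * (((n : ℝ) + 1) * b n - 2 * (n : ℝ) * b (n - 1))) * w ^ n)
      ((-c) ^ 2 * (∑' n, a n * w ^ n) ^ 2
        + (-c) * (1 - 2 * w) * ∑' n : ℕ, ((n : ℝ) + 1) * a n * w ^ n) := by
    refine h2.congr_fun fun n => ?_
    rw [hrec n]
    ring
  rw [h1.unique h3]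
  ring

end Summit.FinalStateConjecture.FinalStateConjecture.Theorems.CrumPeelingRecessiveTower
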